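import Summits.ResolutionOfSingularities.ResolutionOfSingularities.Theorems.EquisingularLiftEquisingularLiftNatNoLevelMark
import Summits.ResolutionOfSingularities.ResolutionOfSingularities.Theorems.EquisingularLiftEquisingularLiftNatNoLevelDoublePlane
import HarnessLib

/-!
# [OURS] GENERAL-TAIL NEGATIVE THEOREM FOR THE 3-JET `x² + y³`: every `y₂² + y₀³ + Ψ` with `Ψ ∈ (y)⁶` (arbitrary tail of order `≥ 6`) has NO finite
# blow-up depth in any blow-up tower (every field) — `E₆, E₇, E₈` need a term of order `4` or `5`
# (cruxes `Theses.EquisingularLift.EquisingularLiftNat` / `…NatThree` / `EquisingularLift`, stmt-ResolutionOfSingularities-20038 / -20148 / -15660)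

[OURS · leafhand-res-equisingularlift-12 g1, 2026-09-01; cell `pub/decomp-res`] AI-produced, weaker than expert review; NOT a statement of any manuscript;
nothing here proves resolution of singularities in positive characteristic.  DEF-FREE helper; no `sorry`; standard axioms; ZERO named hypotheses.

Chart `1` (`y₀ ↦ T₁T₀`, `y₂ ↦ T₁T₂`) of the blow-up of the origin of `Spec K[y]/(y₂² + y₀³ + Ψ)` carries `G = T₂² + (T₁T₀³ + T₁⁴·Ψ')`
(`Ψ(T₁T₀, T₁, T₁T₂) = T₁⁶Ψ'`) at its origin: a double point with 3-jet `T₂²`, which has no level by ✓ `towerLevel_none_origin_sq_add_pow_four`; the origin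
inherits «no level» by ✓ `towerLevel_none_origin_of_mark` (mark `λ = 0`).  The tail `Ψ` is ARBITRARY of order `≥ 6` (e.g. `x² + y³ + z⁶ + xyz⁴ + …`,
`x² + y³ + y²z⁴`, …); the generalisation of ✓ `towerLevel_none_origin_x2y3zk`.

* ★★★ `OneStep.towerLevel_none_origin_sq_add_cube_add_pow_six` — `Ψ ∈ (y)⁶` ⟹ `∀ n, ¬ D n (Spec K[y₀,y₁,y₂]/(y₂² + (y₀³ + Ψ))) (origin)`.

Closes no registered stub.

References: [StacksProject, Tags 0804, 080E]; [Matsumura1987, Thm. 14.2]; [Lipman1969, §24]; through the cited tree files.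
-/

set_option linter.dupNamespace false -- mandated namespace `Summit.<Summit>.<Problem>` of this single-conjunct summit

noncomputable section

open CategoryTheory CategoryTheory.Limits AlgebraicGeometry TopologicalSpace Topology
open MvPolynomial
open Literature.AlgebraicGeometry.Resolution
open AlgebraicGeometry.Scheme.IdealSheafData

namespace Summit.ResolutionOfSingularities.ResolutionOfSingularities.Cruxes.EquisingularLiftNat.Sections

namespace OneStep

variable (K : Type) [Field K]

/-- ★★★ **`y₂² + y₀³ + Ψ`, `Ψ ∈ (y)⁶`, HAS NO BLOW-UP DEPTH** (every field, every blow-up tower, arbitrary tail). [OURS] [cite: StacksProject, Tag 0804]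
[cite: Matsumura1987, Thm. 14.2] [cite: Lipman1969, §24] -/
theorem towerLevel_none_origin_sq_add_cube_add_pow_six (D : ℕ → ∀ Γ : Scheme.{0}, Γ → Prop)
    (hD0 : ∀ (Γ : Scheme.{0}) (y : Γ), IsClosed (({y} : Set Γ)) →
      (D 0 Γ y ↔ ∀ (hy : IsClosed (({y} : Set Γ))) (Z : Scheme.{0}) (τ : Z ⟶ Γ), IsBlowup τ (vanishingIdeal ⟨{y}, hy⟩) →
        ∀ z : Z, τ z = y → IsRegularLocalRing (Z.presheaf.stalk z)))
    (hDsucc : ∀ (d : ℕ) (Γ : Scheme.{0}) (y : Γ), IsClosed (({y} : Set Γ)) →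
      (D (d + 1) Γ y ↔ ∀ (hy : IsClosed (({y} : Set Γ))) (Z : Scheme.{0}) (τ : Z ⟶ Γ), IsBlowup τ (vanishingIdeal ⟨{y}, hy⟩) →
        ∃ S' : Finset Z, (∀ z : Z, τ z = y → z ∉ S' → IsRegularLocalRing (Z.presheaf.stalk z)) ∧
          ∀ z ∈ S', τ z = y ∧ IsClosed (({z} : Set Z)) ∧ ∃ d' ≤ d, D d' Z z))
    (Ψ : MvPolynomial (Fin 3) K) (hΨ : Ψ ∈ Ideal.span (Set.range (X : Fin 3 → MvPolynomial (Fin 3) K)) ^ 6)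
    (y₀ : Spec (CommRingCat.of (MvPolynomial (Fin 3) K ⧸ Ideal.span {(X 2 ^ 2 : MvPolynomial (Fin 3) K) + (X 0 ^ 3 + Ψ)})))
    (hy₀ : y₀.asIdeal = Ideal.map (Ideal.Quotient.mk (Ideal.span {(X 2 ^ 2 : MvPolynomial (Fin 3) K) + (X 0 ^ 3 + Ψ)}))
      (Ideal.span (Set.range (X : Fin 3 → MvPolynomial (Fin 3) K)))) (n : ℕ) :
    ¬ D n (Spec (CommRingCat.of (MvPolynomial (Fin 3) K ⧸ Ideal.span {(X 2 ^ 2 : MvPolynomial (Fin 3) K) + (X 0 ^ 3 + Ψ)}))) y₀ := by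
  classical
  set I : Ideal (MvPolynomial (Fin 3) K) := Ideal.span (Set.range (X : Fin 3 → MvPolynomial (Fin 3) K)) with hI
  have hXI : ∀ i : Fin 3, (X i : MvPolynomial (Fin 3) K) ∈ I := fun i => Ideal.subset_span (Set.mem_range_self i)
  have hΦ : (X 2 ^ 2 : MvPolynomial (Fin 3) K).IsHomogeneous 2 := isHomogeneous_X_pow (2 : Fin 3) 2
  have hΦ0 : (X 2 ^ 2 : MvPolynomial (Fin 3) K) ≠ 0 := pow_ne_zero _ (X_ne_zero 2)
  have hΨ3 : (X 0 ^ 3 + Ψ : MvPolynomial (Fin 3) K) ∈ I ^ (2 + 1) :=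
    Ideal.add_mem _ (Ideal.pow_mem_pow (hXI 0) 3) (Ideal.pow_le_pow_right (by norm_num) hΨ)
  -- chart `1`: `Ψ(T₁T₀, T₁, T₁T₂) = T₁⁶·Ψ'`, strict transform `G = T₂² + (T₁T₀³ + T₁⁴Ψ')`
  obtain ⟨Ψ', hΨ'⟩ := FirstOrderPoint.exists_aeval_subst_eq_pow_mul K 1 hΨ
  have hG : aeval (fun j => X 1 * Function.update (X : Fin 3 → MvPolynomial (Fin 3) K) 1 1 j) ((X 2 ^ 2 : MvPolynomial (Fin 3) K) + (X 0 ^ 3 + Ψ)) =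
      X 1 ^ 2 * (X 2 ^ 2 + (X 1 * X 0 ^ 3 + X 1 ^ 4 * Ψ')) := by
    rw [map_add, map_add, hΨ', map_pow, map_pow, aeval_X, aeval_X, Function.update_of_ne (by decide : (2 : Fin 3) ≠ 1),
      Function.update_of_ne (by decide : (0 : Fin 3) ≠ 1)]
    ring
  have hB : (X 1 * X 0 ^ 3 + X 1 ^ 4 * Ψ' : MvPolynomial (Fin 3) K) ∈ I ^ 4 := by
    refine Ideal.add_mem _ ?_ (Ideal.mul_mem_right _ _ (Ideal.pow_mem_pow (hXI 1) 4))
    have e : (4 : ℕ) = 1 + 3 := rfl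
    rw [e, pow_add, pow_one]
    exact Ideal.mul_mem_mul (hXI 1) (Ideal.pow_mem_pow (hXI 0) 3)
  have hG0 : (X 2 ^ 2 + (X 1 * X 0 ^ 3 + X 1 ^ 4 * Ψ') : MvPolynomial (Fin 3) K) ≠ 0 := by
    intro h
    have h1 := congrArg (eval (Pi.single (2 : Fin 3) (1 : K))) h
    simp at h1
  -- the mark `λ = 0`: `G ∈ (T)²`, `T₁ ∈ (T)`, translate `= G`
  let 𝔪 : Ideal (MvPolynomial (Fin 3) K) := Ideal.span (Set.range fun i : Fin 3 => (X i - C ((0 : Fin 3 → K) i) : MvPolynomial (Fin 3) K))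
  have hX : ∀ i : Fin 3, (X i : MvPolynomial (Fin 3) K) ∈ 𝔪 := fun i => by
    have h : (X i - C ((0 : Fin 3 → K) i) : MvPolynomial (Fin 3) K) ∈ 𝔪 := Ideal.subset_span ⟨i, rfl⟩
    simpa using h
  have h𝔪I : I ≤ 𝔪 := Ideal.span_le.mpr (Set.range_subset_iff.mpr fun i => hX i)
  have hG2 : (X 2 ^ 2 + (X 1 * X 0 ^ 3 + X 1 ^ 4 * Ψ') : MvPolynomial (Fin 3) K) ∈ 𝔪 ^ 2 :=
    Ideal.add_mem _ (Ideal.pow_mem_pow (hX 2) 2) (Ideal.pow_right_mono h𝔪I 2 (Ideal.pow_le_pow_right (by norm_num) hB))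
  have hGH : aeval (fun i : Fin 3 => X i + C ((0 : Fin 3 → K) i)) (X 2 ^ 2 + (X 1 * X 0 ^ 3 + X 1 ^ 4 * Ψ') : MvPolynomial (Fin 3) K) =
      X 2 ^ 2 + (X 1 * X 0 ^ 3 + X 1 ^ 4 * Ψ') := SecondOrderPoint.aeval_translate_zero K _
  exact towerLevel_none_origin_of_mark K D hD0 hDsucc (X 2 ^ 2) (X 0 ^ 3 + Ψ) (by norm_num) hΦ hΦ0 hΨ3 1 _ hG0 hG 0 (hX 1) hG2 _ hGH
    (fun y' hy' m => towerLevel_none_origin_sq_add_pow_four K D hD0 hDsucc _ hB y' hy' m) y₀ hy₀ n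

end OneStep

end Summit.ResolutionOfSingularities.ResolutionOfSingularities.Cruxes.EquisingularLiftNat.Sections

end
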